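import Summits.BirchSwinnertonDyer.BirchSwinnertonDyer.Theorems.EisensteinPrimesLineCharactersAtMultiplicativePlace
import Literature.NumberTheory.EllipticCurves.SupersingularIrreducibleProofs
import Literature.NumberTheory.EllipticCurves.OpenImageMazurProofs
import Literature.NumberTheory.EllipticCurves.LFunctionPrimeCoeff
import HarnessLib

/-!
# Route `EisensteinPrimes`, crux 2 `GoodLatticeBDPValue` (stmt-BirchSwinnertonDyer-19032), line `halves` v21 —
# stub 3a-B `stub_fullDescentAtThreeOfRed` (Theorem T′): THE ASSEMBLY SHELL

Cell `bsd-eis` (home `run/shared/lean/pub/bsd-eis/`), LEAD seat `bsd-line-x1-p1` (gen 5; `--supports -19032`, closes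
nothing by itself). The registered stub 3a-B reads: for `W/ℚ` globally minimal, `p = 3` good with `E[3]` reducible,
EITHER an additive prime exists OR a multiplicative prime `ℓ` exists that is split with `ℓ ≡ 1 (mod 3)` or non-split with
`ℓ + 1 ≡ 0 (mod 3)` (a «full-descent datum», Kriz 2016 Thm. 34/35). The width seats of the crux build it brick-wise along
the elementary road `HOME/line-x1-p1-w3-g4/AN3-StubB-elementary-road.md` (Galois module `E[9]`, no Hecke algebras). THIS
FILE is the LEAD's assembly: it proves the registered statement, token for token, from THREE global pieces stated here as
hypotheses in the currency the bricks use —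

* `hS` — **Lemma S′** (w2 gen 5, `FullDescentLemmaS.lineCharacter_three_dichotomy` with its local unipotence input
  discharged): for `W` semistable and good at `3`, the isogeny character `r` of a point `P ≠ 0` of `E[3]` spanning a
  rational line is `𝟙` or `χ̄₃`;
* `hB` — **Theorem B** (Case `𝟙` ⇒ Case `ω`): `3` good ordinary, every place `v ∤ 3` good or SPLIT multiplicative with
  `ℓ_v ≡ 2 (mod 3)`, and a `Γ_ℚ`-fixed `P ≠ 0` in `E[3]` ⟹ a point `Q ≠ 0` of `E[3]` on which `Γ_ℚ` acts through `χ̄₃`;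
* `hA` — **Theorem A** (Case `ω` ⇒ ⊥): the same local hypotheses and such a `Q` ⟹ `False`;

— and from TREE THEOREMS for everything else: the reducibility dictionary (`Mazur1978.not_hasIrreducibleModPGaloisRep_iff_
exists_natCard_eq`, `exists_isogenyCharacter`, the shape `(r *; 0 χ̄ r⁻¹)`), ordinarity of a good Eisenstein `3`
(`Rank1Residual.goodOrd_of_red_of_good`, Serre 1972 Prop. 12), the prime/place dictionary over `ℚ`
(`hasGoodReductionAtPrime_iff_hasGoodReductionAt_ringOfIntegers`, `hasSplitMultiplicativeReductionAt_of_mem`), and the LOCAL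
step L2 of the memo — **a non-split multiplicative `ℓ ≠ 3` has `ℓ ≡ 2 (mod 3)`** — which is x2-p1-w7's
`lineChars_natCast_of_not_hasSplitMultiplicativeReductionAtPrime` (twisted Tate curve: `{φ(ℓ), ψ(ℓ)} = {−ℓ, −1}`) read on
the `𝟙`-line (`φ = 𝟙`, `ψ = χ̄₃`) or the `ω`-line (`φ = χ̄₃`, `ψ = 𝟙`).

Logic of `fullDescentAtThreeOfRed_of_pieces`: if some prime is additive we are done; else `W` is semistable; if no
multiplicative prime carries the datum then (split ⇒ `ℓ ≢ 1`, `ℓ ≠ 3` ⇒ `ℓ ≡ 2`; non-split ⇒ `ℓ ≢ 2` contradicts L2)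
every place `∤ 3` is good or split with `ℓ ≡ 2 (mod 3)`; the rational line (from `Red`) has character `𝟙` or `ω` (`hS`);
`𝟙` ⇒ `ω` (`hB`) ⇒ ⊥ (`hA`).

HONEST FRAMING: a sorry-free CONDITIONAL assembly (hypotheses `hS hB hA` are the open bricks F6-full / F8 / F7 of the road,
being proved by the width seats; when they land the LEAD instantiates this theorem and the registered stub closes BY NAME).
0 definitions, 0 named facts, 0 sorry. No summit statement, no BSD / IMC / Keller–Yin theorem, no stub of the registered
skeleton is proved here. References: [Kriz2016] Thm. 34 (1)–(3), Thm. 35, Def. 31, Rem. 32; [Serre1972] §1.11 Prop. 12,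
§1.12; [Mazur1978] §5 (pp. 148–152); [GreenbergVatsal2000] §2 pp. 14–15; [SilvermanATAEC1994] V.5.3, Cor. 5.4, Ex. 5.11.
-/

set_option autoImplicit false

-- the route's Theorems namespace repeats the summit name by design (D-0017 nested layout)
set_option linter.dupNamespace false

noncomputable section

open scoped Classical NumberField

namespace Summit.BirchSwinnertonDyer.BirchSwinnertonDyer.Theorems.FullDescentAssembly

open NumberField IsDedekindDomain Field WeierstrassCurve Rat.HeightOneSpectrum
  Literature.NumberTheory.EllipticCurves Literature.NumberTheory.GaloisRepresentations
  Literature.NumberTheory.EllipticCurves.Rank1Residual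
  Summit.BirchSwinnertonDyer.BirchSwinnertonDyer.Theorems.EisensteinPrimesLineCharactersAtMultiplicativePlace

/-! ## §1. Small arithmetic in `ℤ/3` -/

/-- `(ℓ : ℤ/3) = −1` means `ℓ ≡ 2 (mod 3)`. [folklore] -/
theorem mod_three_eq_two_of_natCast_eq_neg_one {ℓ : ℕ} (h : (ℓ : ZMod 3) = -1) : ℓ % 3 = 2 := by
  have hv := congrArg ZMod.val h
  rw [ZMod.val_natCast] at hv
  exact hv.trans (by decide)

/-- In `ℤ/3`, `1 ≠ −1`. [folklore] -/
theorem one_ne_neg_one_zmod_three : (1 : ZMod 3) ≠ -1 := by decide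

/-- A prime `ℓ ≠ 3` with `ℓ % 3 ≠ 2` has `ℓ ≡ 1 (mod 3)`. [folklore] -/
theorem modEq_one_of_prime_of_ne {ℓ : ℕ} (hℓ : ℓ.Prime) (h3 : ℓ ≠ 3) (h2 : ℓ % 3 ≠ 2) : ℓ ≡ 1 [MOD 3] := by
  have h0 : ℓ % 3 ≠ 0 := by
    intro h0
    exact h3 ((Nat.prime_dvd_prime_iff_eq Nat.prime_three hℓ).mp (Nat.dvd_of_mod_eq_zero h0)).symm
  have hlt : ℓ % 3 < 3 := Nat.mod_lt _ (by norm_num)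
  show ℓ % 3 = 1 % 3
  omega

/-! ## §2. The rational line `⟨P⟩` and the two character shapes used by the local dichotomy -/

variable {W : WeierstrassCurve ℚ} [W.IsElliptic]

omit [W.IsElliptic] in
/-- The line `⟨P⟩` spanned by a point `P ≠ 0` of `E[3]` carrying an isogeny character is a rational `3`-line
(order `3`, `Γ_ℚ`-stable). [folklore] -/
theorem isRationalLine_zmultiples {P : geomTorsion W ((3 : ℕ) : ℤ)} (hP0 : P ≠ 0)
    {r : absoluteGaloisGroup ℚ →* (ZMod 3)ˣ}
    (hr : ∀ σ : absoluteGaloisGroup ℚ, σ • P = ((r σ : (ZMod 3)ˣ) : ZMod 3).val • P) :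
    IsRationalLine W 3 (AddSubgroup.zmultiples P) := by
  refine ⟨?_, fun σ Q hQ ↦ ?_⟩
  · rw [Nat.card_zmultiples, addOrderOf_eq_of_ne_zero W 3 hP0]
  · obtain ⟨k, rfl⟩ := AddSubgroup.mem_zmultiples_iff.mp hQ
    have h1 : σ • (k • P) = k • (σ • P) := map_zsmul (DistribSMul.toAddMonoidHom _ σ) k P
    rw [h1, hr σ]
    exact AddSubgroup.zsmul_mem _ (AddSubgroup.nsmul_mem _ (AddSubgroup.mem_zmultiples P) _) _

omit [W.IsElliptic] in
/-- On the line `⟨P⟩`, `Γ_ℚ` acts through the character `r` of `P`: `σ Q = r(σ) Q` for every `Q ∈ ⟨P⟩`. [folklore] -/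
theorem smul_eq_of_mem_zmultiples {P : geomTorsion W ((3 : ℕ) : ℤ)}
    {r : absoluteGaloisGroup ℚ →* (ZMod 3)ˣ}
    (hr : ∀ σ : absoluteGaloisGroup ℚ, σ • P = ((r σ : (ZMod 3)ˣ) : ZMod 3).val • P)
    (σ : absoluteGaloisGroup ℚ) {Q : geomTorsion W ((3 : ℕ) : ℤ)} (hQ : Q ∈ AddSubgroup.zmultiples P) :
    σ • Q = ((r σ : (ZMod 3)ˣ) : ZMod 3).val • Q := by
  obtain ⟨k, rfl⟩ := AddSubgroup.mem_zmultiples_iff.mp hQ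
  have h1 : σ • (k • P) = k • (σ • P) := map_zsmul (DistribSMul.toAddMonoidHom _ σ) k P
  rw [h1, hr σ, smul_comm]

/-- The `(r *; 0 χ̄₃ r⁻¹)` shape on `E[3]/⟨P⟩`, with the mod `3` cyclotomic character under its tree name
`modNCyclotomicCharacter`. [cite: Mazur1978, §5 (p. 148) and §6 proof of Prop. 6.3 (p. 153)] -/
theorem smul_sub_smul_mem_zmultiples {P : geomTorsion W ((3 : ℕ) : ℤ)} (hP0 : P ≠ 0)
    {r : absoluteGaloisGroup ℚ →* (ZMod 3)ˣ}
    (hr : ∀ σ : absoluteGaloisGroup ℚ, σ • P = ((r σ : (ZMod 3)ˣ) : ZMod 3).val • P)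
    (σ : absoluteGaloisGroup ℚ) (S : geomTorsion W ((3 : ℕ) : ℤ)) :
    σ • S - (((modNCyclotomicCharacter ℚ 3 σ : (ZMod 3)ˣ) : ZMod 3) *
        (((r σ)⁻¹ : (ZMod 3)ˣ) : ZMod 3)).val • S ∈ AddSubgroup.zmultiples P :=
  Mazur1978.smul_sub_smul_mem_zmultiples_of_isogenyCharacter W 3 hP0 hr σ S

/-! ## §3. L2 of the road: a NON-split multiplicative prime `ℓ ≠ 3` has `ℓ ≡ 2 (mod 3)` -/

/-- **A non-split multiplicative prime `ℓ ≠ 3` of a curve whose rational `3`-line is the `𝟙`-line or the `ω`-line has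
`ℓ ≡ 2 (mod 3)`.** At the place `v = (ℓ)` the twisted Tate curve gives `{φ(ℓ), ψ(ℓ)} = {−ℓ, −1}` for the line character
`φ` and the quotient character `ψ` (x2-p1-w7's `lineChars_natCast_of_not_hasSplitMultiplicativeReductionAtPrime`, odd `ℓ`;
`ℓ = 2` is `≡ 2` anyway); on the `𝟙`-line `(φ, ψ) = (𝟙, χ̄₃)` and on the `ω`-line `(φ, ψ) = (χ̄₃, 𝟙)`, and either reading
forces `ℓ ≡ −1 (mod 3)`. [cite: Kriz2016, Thm. 34 (2)] [cite: GreenbergVatsal2000, §2 pp. 14–15]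
[cite: SilvermanATAEC1994, Ch. V Thm. 5.3, Cor. 5.4, Ex. 5.11] -/
theorem natGenerator_mod_three_eq_two_of_not_split [W.IsGloballyMinimal]
    {P : geomTorsion W ((3 : ℕ) : ℤ)} (hP0 : P ≠ 0) {r : absoluteGaloisGroup ℚ →* (ZMod 3)ˣ}
    (hr : ∀ σ : absoluteGaloisGroup ℚ, σ • P = ((r σ : (ZMod 3)ˣ) : ZMod 3).val • P)
    (hS : (∀ σ : absoluteGaloisGroup ℚ, r σ = 1) ∨
      (∀ σ : absoluteGaloisGroup ℚ, r σ = modNCyclotomicCharacter ℚ 3 σ))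
    (v : HeightOneSpectrum (𝓞 ℚ)) (hv3 : natGenerator v ≠ 3)
    (hmult : haveI := Fact.mk (primesEquiv v).2; W.HasMultiplicativeReductionAtPrime (primesEquiv v : ℕ))
    (hns : haveI := Fact.mk (primesEquiv v).2; ¬ W.HasSplitMultiplicativeReductionAtPrime (primesEquiv v : ℕ)) :
    natGenerator v % 3 = 2 := by
  haveI : Fact (Nat.Prime 3) := ⟨Nat.prime_three⟩
  haveI hℓ : Fact (primesEquiv v : ℕ).Prime := Fact.mk (primesEquiv v).2
  by_cases h2 : natGenerator v = 2
  · rw [h2]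
  have hv : ((primesEquiv v : Nat.Primes) : ℕ) = natGenerator v := rfl
  have hΦ := isRationalLine_zmultiples hP0 hr
  -- `ℓ` is a unit mod `3`
  have hℓ3 : ¬ natGenerator v ∣ 3 := fun h ↦
    hv3 ((Nat.prime_dvd_prime_iff_eq (prime_natGenerator v) Nat.prime_three).mp h)
  have hu : IsUnit ((natGenerator v : ℕ) : ZMod 3) := by
    rw [← ZMod.coe_unitOfCoprime (natGenerator v) ((Nat.coprime_primes (prime_natGenerator v)
      Nat.prime_three).mpr (fun h ↦ hv3 h))]
    exact Units.isUnit _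
  obtain ⟨u, hu'⟩ := hu
  -- the identity Dirichlet character mod `3` with values in `ℤ/3`
  set idχ : DirichletCharacter (ZMod 3) 3 := MulChar.ofUnitHom (MonoidHom.id (ZMod 3)ˣ) with hidχ
  have hidχ_apply : ∀ w : (ZMod 3)ˣ, idχ (w : ZMod 3) = (w : ZMod 3) := fun w ↦ by
    rw [hidχ, MulChar.ofUnitHom_coe, MonoidHom.id_apply]
  have hidχ_ℓ : idχ ((natGenerator v : ℕ) : ZMod 3) = ((natGenerator v : ℕ) : ZMod 3) := by
    rw [← hu', hidχ_apply]
  have hone_ℓ1 : (1 : DirichletCharacter (ZMod 3) 1) ((natGenerator v : ℕ) : ZMod 1) = 1 :=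
    MulChar.one_apply (isUnit_of_subsingleton _)
  rcases hS with h1 | hω
  · -- the `𝟙`-line: `φ = 𝟙` (mod 1), `ψ = χ̄₃` (mod 3)
    have hφ0 : ∀ σ : absoluteGaloisGroup ℚ, ∀ Q ∈ AddSubgroup.zmultiples P,
        σ • Q = ((1 : DirichletCharacter (ZMod 3) 1)
          ((modNCyclotomicCharacter ℚ 1 σ : (ZMod 1)ˣ) : ZMod 1)).val • Q := by
      intro σ Q hQ
      rw [MulChar.one_apply_coe, smul_eq_of_mem_zmultiples hr σ hQ, h1 σ, Units.val_one]
    have hψ0 : ∀ (σ : absoluteGaloisGroup ℚ) (Q : geomTorsion W ((3 : ℕ) : ℤ)),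
        σ • Q - (idχ ((modNCyclotomicCharacter ℚ 3 σ : (ZMod 3)ˣ) : ZMod 3)).val • Q ∈
          AddSubgroup.zmultiples P := by
      intro σ Q
      have h := smul_sub_smul_mem_zmultiples hP0 hr σ Q
      rwa [h1 σ, inv_one, Units.val_one, mul_one, ← hidχ_apply] at h
    rcases lineChars_natCast_of_not_hasSplitMultiplicativeReductionAtPrime (p := 3) hv hv3 h2 hmult hns hΦ
        (1 : DirichletCharacter (ZMod 3) 1) (fun h ↦ (prime_natGenerator v).ne_one (Nat.dvd_one.mp h)) idχ hℓ3 hφ0 hψ0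
      with ⟨hφ, -⟩ | ⟨hφ, -⟩
    · rw [hone_ℓ1] at hφ
      exact mod_three_eq_two_of_natCast_eq_neg_one (neg_eq_iff_eq_neg.mp hφ.symm)
    · rw [hone_ℓ1] at hφ
      exact absurd hφ one_ne_neg_one_zmod_three
  · -- the `ω`-line: `φ = χ̄₃` (mod 3), `ψ = 𝟙` (mod 1)
    have hφ0 : ∀ σ : absoluteGaloisGroup ℚ, ∀ Q ∈ AddSubgroup.zmultiples P,
        σ • Q = (idχ ((modNCyclotomicCharacter ℚ 3 σ : (ZMod 3)ˣ) : ZMod 3)).val • Q := by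
      intro σ Q hQ
      rw [hidχ_apply, smul_eq_of_mem_zmultiples hr σ hQ, hω σ]
    have hψ0 : ∀ (σ : absoluteGaloisGroup ℚ) (Q : geomTorsion W ((3 : ℕ) : ℤ)),
        σ • Q - ((1 : DirichletCharacter (ZMod 3) 1)
          ((modNCyclotomicCharacter ℚ 1 σ : (ZMod 1)ˣ) : ZMod 1)).val • Q ∈ AddSubgroup.zmultiples P := by
      intro σ Q
      have h := smul_sub_smul_mem_zmultiples hP0 hr σ Q
      have hval : ((1 : DirichletCharacter (ZMod 3) 1)
          ((modNCyclotomicCharacter ℚ 1 σ : (ZMod 1)ˣ) : ZMod 1)).val =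
            (((modNCyclotomicCharacter ℚ 3 σ : (ZMod 3)ˣ) : ZMod 3) *
              (((r σ)⁻¹ : (ZMod 3)ˣ) : ZMod 3)).val := by
        rw [MulChar.one_apply_coe, hω σ, Units.mul_inv]
      rwa [← hval] at h
    rcases lineChars_natCast_of_not_hasSplitMultiplicativeReductionAtPrime (p := 3) hv hv3 h2 hmult hns hΦ
        idχ hℓ3 (1 : DirichletCharacter (ZMod 3) 1) (fun h ↦ (prime_natGenerator v).ne_one (Nat.dvd_one.mp h)) hφ0 hψ0
      with ⟨-, hψ⟩ | ⟨-, hψ⟩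
    · rw [hone_ℓ1] at hψ
      exact absurd hψ one_ne_neg_one_zmod_three
    · rw [hone_ℓ1] at hψ
      exact mod_three_eq_two_of_natCast_eq_neg_one (neg_eq_iff_eq_neg.mp hψ.symm)

/-! ## §4. The assembly: stub 3a-B from Lemma S′, Theorem B and Theorem A -/

/-- **Stub 3a-B of halves v21 (`stub_fullDescentAtThreeOfRed`, Theorem T′) ASSEMBLED from the three global pieces of
the AN-3 road** — `hS` (Lemma S′: the rational `3`-line of a semistable curve good at `3` is the `𝟙`- or the `ω`-line),
`hB` (Case `𝟙` ⇒ Case `ω`) and `hA` (Case `ω` ⇒ ⊥), each under «`3` good ordinary, every place `∤ 3` good or split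
multiplicative with residue characteristic `≡ 2 (mod 3)`» — and tree theorems (reducibility dictionary, ordinarity of a good
Eisenstein `3`, prime/place dictionary, the local step L2 `natGenerator_mod_three_eq_two_of_not_split`). The conclusion is
the registered statement of the stub, token for token. [cite: Kriz2016, Thm. 34 (1)–(3), Thm. 35, Def. 31, Rem. 32]
[cite: Serre1972, §1.11 Prop. 12] [cite: Mazur1978, §5 (pp. 148–152)] -/
theorem fullDescentAtThreeOfRed_of_pieces
    (hS : ∀ (W : WeierstrassCurve ℚ) [W.IsElliptic] [W.IsGloballyMinimal],
      W.HasGoodReductionAtPrime 3 → Semistable W →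
      ∀ {P : geomTorsion W ((3 : ℕ) : ℤ)}, P ≠ 0 → ∀ {r : absoluteGaloisGroup ℚ →* (ZMod 3)ˣ},
        (∀ σ : absoluteGaloisGroup ℚ, σ • P = ((r σ : (ZMod 3)ˣ) : ZMod 3).val • P) →
        (∀ σ : absoluteGaloisGroup ℚ, r σ = 1) ∨
          (∀ σ : absoluteGaloisGroup ℚ, r σ = modNCyclotomicCharacter ℚ 3 σ))
    (hB : ∀ (W : WeierstrassCurve ℚ) [W.IsElliptic] [W.IsGloballyMinimal],
      W.HasGoodReductionAtPrime 3 → ¬ (3 : ℤ) ∣ W.frobeniusTrace 3 →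
      (∀ v : HeightOneSpectrum (𝓞 ℚ), natGenerator v ≠ 3 →
        W.HasGoodReductionAt v ∨ (W.HasSplitMultiplicativeReductionAt v ∧ natGenerator v % 3 = 2)) →
      ∀ P : geomTorsion W ((3 : ℕ) : ℤ), P ≠ 0 → (∀ σ : absoluteGaloisGroup ℚ, σ • P = P) →
        ∃ Q : geomTorsion W ((3 : ℕ) : ℤ), Q ≠ 0 ∧
          ∀ σ : absoluteGaloisGroup ℚ, σ • Q = ((modNCyclotomicCharacter ℚ 3 σ : (ZMod 3)ˣ) : ZMod 3).val • Q)
    (hA : ∀ (W : WeierstrassCurve ℚ) [W.IsElliptic] [W.IsGloballyMinimal],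
      W.HasGoodReductionAtPrime 3 → ¬ (3 : ℤ) ∣ W.frobeniusTrace 3 →
      (∀ v : HeightOneSpectrum (𝓞 ℚ), natGenerator v ≠ 3 →
        W.HasGoodReductionAt v ∨ (W.HasSplitMultiplicativeReductionAt v ∧ natGenerator v % 3 = 2)) →
      ∀ Q : geomTorsion W ((3 : ℕ) : ℤ), Q ≠ 0 →
        (∀ σ : absoluteGaloisGroup ℚ, σ • Q = ((modNCyclotomicCharacter ℚ 3 σ : (ZMod 3)ˣ) : ZMod 3).val • Q) →
        False) :
    ∀ (W : WeierstrassCurve ℚ) [W.IsElliptic] [W.IsGloballyMinimal] (p : ℕ) [Fact p.Prime],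
      p = 3 → Good W p → Red W p →
      ((∃ (ℓ : ℕ) (hℓ : ℓ.Prime), haveI : Fact ℓ.Prime := ⟨hℓ⟩; Addv W ℓ) ∨
        (∃ (ℓ : ℕ) (hℓ : ℓ.Prime), haveI : Fact ℓ.Prime := ⟨hℓ⟩;
          W.HasMultiplicativeReductionAtPrime ℓ ∧
            ((W.HasSplitMultiplicativeReductionAtPrime ℓ ∧ ℓ ≡ 1 [MOD p]) ∨
              (¬ W.HasSplitMultiplicativeReductionAtPrime ℓ ∧ ℓ + 1 ≡ 0 [MOD p])))) := by
  intro W _ _ p _ hp hgood hred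
  subst hp
  by_cases hadd : ∃ (ℓ : ℕ) (hℓ : ℓ.Prime), haveI : Fact ℓ.Prime := ⟨hℓ⟩; Addv W ℓ
  · exact Or.inl hadd
  right
  -- no additive prime: `W` is semistable
  have hsemi : Semistable W := by
    intro ℓ hℓ
    haveI : Fact ℓ.Prime := ⟨hℓ⟩
    by_contra h
    rw [not_or] at h
    exact hadd ⟨ℓ, hℓ, h⟩
  by_contra hno
  -- ordinarity of the good Eisenstein prime `3`
  have hord : ¬ (3 : ℤ) ∣ W.frobeniusTrace 3 := (goodOrd_of_red_of_good W 3 (by norm_num) hgood hred).2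
  -- the rational line and its isogeny character
  obtain ⟨H, hHst, hHcard⟩ := (Mazur1978.not_hasIrreducibleModPGaloisRep_iff_exists_natCard_eq W 3).mp hred
  obtain ⟨P, hP0, rfl⟩ := Mazur1978.exists_eq_zmultiples_of_natCard_eq W 3 hHcard
  obtain ⟨r, hr⟩ := Mazur1978.exists_isogenyCharacter W 3 hP0 (fun σ ↦ hHst σ P (AddSubgroup.mem_zmultiples P))
  have hS' := hS W hgood hsemi hP0 hr
  -- the local hypothesis H: every place `∤ 3` is good, or split multiplicative with `ℓ ≡ 2 (mod 3)`
  have hH : ∀ v : HeightOneSpectrum (𝓞 ℚ), natGenerator v ≠ 3 →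
      W.HasGoodReductionAt v ∨ (W.HasSplitMultiplicativeReductionAt v ∧ natGenerator v % 3 = 2) := by
    intro v hv3
    haveI hℓ : Fact (primesEquiv v : ℕ).Prime := Fact.mk (primesEquiv v).2
    have hv : ((primesEquiv v : Nat.Primes) : ℕ) = natGenerator v := rfl
    rcases hsemi (primesEquiv v : ℕ) (primesEquiv v).2 with hg | hm
    · exact Or.inl ((hasGoodReductionAtPrime_iff_hasGoodReductionAt_ringOfIntegers v W).mp hg)
    · right
      by_cases hsplit : W.HasSplitMultiplicativeReductionAtPrime (primesEquiv v : ℕ)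
      · refine ⟨Summit.BirchSwinnertonDyer.Rank1Residual.X2.GreenbergVatsalStrictSelmerMultiplicative.hasSplitMultiplicativeReductionAt_of_mem W
          (primesEquiv v : ℕ) hsplit (natCast_mem_asIdeal_of_primesEquiv_eq hv), ?_⟩
        by_contra h2
        exact hno ⟨(primesEquiv v : ℕ), (primesEquiv v).2, hm, Or.inl ⟨hsplit,
          modEq_one_of_prime_of_ne (prime_natGenerator v) hv3 h2⟩⟩
      · exfalso
        have h2 := natGenerator_mod_three_eq_two_of_not_split hP0 hr hS' v hv3 hm hsplit
        refine hno ⟨(primesEquiv v : ℕ), (primesEquiv v).2, hm, Or.inr ⟨hsplit, ?_⟩⟩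
        show (natGenerator v + 1) % 3 = 0 % 3
        omega
  rcases hS' with h1 | hω
  · have hfix : ∀ σ : absoluteGaloisGroup ℚ, σ • P = P := fun σ ↦ by
      rw [hr σ, h1 σ, Units.val_one, ZMod.val_one, one_smul]
    obtain ⟨Q, hQ0, hQ⟩ := hB W hgood hord hH P hP0 hfix
    exact hA W hgood hord hH Q hQ0 hQ
  · exact hA W hgood hord hH P hP0 (fun σ ↦ by rw [hr σ, hω σ])

end Summit.BirchSwinnertonDyer.BirchSwinnertonDyer.Theorems.FullDescentAssembly

end
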